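import Summits.AtomisticToContinuum.Crystallization.Theorems.BraggSlacknessRigidityStrictCertificateEinstein
import Summits.AtomisticToContinuum.Crystallization.Theorems.BraggSlacknessRigidityStrictCertificateSingleSite

/-!
# Crux `StrictCertificate` (stmt-AtomisticToContinuum-13167, route `BraggSlacknessRigidity`):
# necessary conditions on a witness, VI — the `g`-FREE Einstein bound by the Lennard-Jones cavity

Support file for the line `registered` (lead c4); nothing here closes the item.  For a witness
`⟨P, ρ, c, g, U, f⟩` (any three-cone split `IsSplit ρ c g U f` of `V = V_LJ` attaining the periodic
configuration `P`), a site `p₀ ∈ P` and a probe `w ∉ P`: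

* `singleSite_stability_of_isSplit` — the finite-range cone is single-site stable,
  `0 ≤ Σ'_{y ≠ p₀} [g(dist w y) − g(dist p₀ y)]` (`g` is `(−c)`-stable, `e_g(P) = −c` by
  `Slackness.energyPerParticle_g_eq`; previous file `singleSite_stability`);
* `f_zero_sub_f_le_lennardJones_cavity` — hence, from Einstein domination (`f_zero_sub_f_le_cavity_split`),
  **`f 0 − f(dist w p₀) ≤ Σ'_{y ∈ P, y ≠ p₀} [V(dist w y) − V(dist p₀ y)] =: ΔE_V(p₀ ↦ w)`** — the drop
  of the Bochner kernel below its maximum is dominated by the Lennard-Jones CAVITY EXCESS of the template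
  alone: no unknown of the certificate is left on the right-hand side;
* `f_zero_sub_f_norm_le` — displacement form `w = p₀ + u`: `f 0 − f ‖u‖ ≤ ΔE_V(u)`;
* `two_mul_f_zero_sub_f_norm_le` — symmetrised over `±u`:
  `2 (f 0 − f ‖u‖) ≤ Σ'_{y ≠ p₀} [V(dist (p₀+u) y) + V(dist (p₀−u) y) − 2 V(dist p₀ y)]`, a lattice
  sum of symmetric SECOND DIFFERENCES of `V∘dist(·, y)` — the form in which the right-hand side is
  `O(‖u‖²)` (next file: one-variable Taylor bound for `Ṽ(s) = s⁻⁶/12 − s⁻³/6`), which makes the kernel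
  `C^{1,1}` at the origin and its Fourier transform's second moment finite;
* `einsteinLJ_of_clauses` — registered sub-goal, crux conjuncts 2–7 verbatim as hypotheses.

All `[folklore]` (complementary slackness at a displaced site; Einstein-oscillator energies).
-/

noncomputable section

namespace Summit.AtomisticToContinuum.Crystallization.Theorems.BraggSlacknessRigidityStrictCertificate

open Literature.MathematicalPhysics.StatisticalMechanics
open Summit.AtomisticToContinuum.Crystallization.Theorems.ExactCertificateNegative (IsSplit)
open Summit.AtomisticToContinuum.Crystallization.Theorems.ChargedEnergyGapNegative (E3)
open Summit.AtomisticToContinuum.Crystallization.Theorems.ThreeConeCertificateExactCertificate.Slackness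
  (summable_of_finRange energyPerParticle_g_eq)
open scoped BigOperators

/-! ## The finite-range cone of a witness is single-site stable -/

/-- **For a witness `⟨P, ρ, c, g, U, f⟩` the finite-range cone is single-site stable**:
`0 ≤ Σ'_{y ∈ P, y ≠ p₀} [g(dist w y) − g(dist p₀ y)]` for every site `p₀ ∈ P` and probe `w ∉ P`
(`g` is `(−c)`-stable of range `ρ`, and `e_g(P) = −c` by complementary slackness). [folklore] -/
theorem singleSite_stability_of_isSplit {P : PeriodicConfiguration 3} {ρ c : ℝ} {g U f : ℝ → ℝ}
    (h : IsSplit ρ c g U f) (hv : c + f 0 / 2 ≤ -(P.energyPerParticle lennardJones))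
    {p₀ w : E3} (hp₀ : p₀ ∈ P.points) (hw : w ∉ P.points) :
    0 ≤ ∑' y : {y : E3 // y ∈ P.points ∧ y ≠ p₀}, (g (dist w y.1) - g (dist p₀ y.1)) :=
  singleSite_stability P h.g_zero (κ := -c)
    (fun N x hx => by rw [neg_mul]; exact h.stable N x hx)
    (energyPerParticle_g_eq h hv).le hp₀ hw

/-! ## The `g`-free Einstein bound -/

/-- **The Lennard-Jones cavity excess family is summable** (both site families are). [folklore] -/
theorem summable_lennardJones_cavity_excess (P : PeriodicConfiguration 3) {p₀ w : E3}
    (hw : w ∉ P.points) :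
    Summable fun q : {q : E3 // q ∈ P.points ∧ q ≠ p₀} =>
      lennardJones (dist w q.1) - lennardJones (dist p₀ q.1) :=
  (summable_lennardJones_probe P hw).sub (P.summable_lennardJones_dist_three p₀)

/-- **THE `g`-FREE EINSTEIN BOUND.**  For a witness, a site `p₀ ∈ P` and a probe `w ∉ P`:
`f 0 − f(dist w p₀) ≤ Σ'_{y ∈ P, y ≠ p₀} [V(dist w y) − V(dist p₀ y)]` — Einstein domination
(`f_zero_sub_f_le_cavity_split`) minus the non-negative `g`-cavity excess
(`singleSite_stability_of_isSplit`). [folklore] -/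
theorem f_zero_sub_f_le_lennardJones_cavity {P : PeriodicConfiguration 3} {ρ c : ℝ} {g U f : ℝ → ℝ}
    (h : IsSplit ρ c g U f) (hv : c + f 0 / 2 ≤ -(P.energyPerParticle lennardJones))
    {p₀ w : E3} (hp₀ : p₀ ∈ P.points) (hw : w ∉ P.points) :
    f 0 - f (dist w p₀) ≤ ∑' q : {q : E3 // q ∈ P.points ∧ q ≠ p₀},
      (lennardJones (dist w q.1) - lennardJones (dist p₀ q.1)) := by
  have h1 := f_zero_sub_f_le_cavity_split h hv hp₀ hw
  have h2 := singleSite_stability_of_isSplit h hv hp₀ hw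
  linarith

/-- A probe within the nearest-neighbour distance of a site is not a point of the configuration
(unless it is the site). [folklore] -/
theorem not_mem_points_of_dist_lt (P : PeriodicConfiguration 3) {p₀ w : E3} {ρ₁ : ℝ}
    (hsep : ∀ q ∈ P.points, q ≠ p₀ → ρ₁ ≤ dist p₀ q) (hw : dist p₀ w < ρ₁) (hne : w ≠ p₀) :
    w ∉ P.points := fun hmem => (not_le.2 hw) (hsep w hmem hne)

/-- **Displacement form**: for `u` with `p₀ + u ∉ P`,
`f 0 − f ‖u‖ ≤ Σ'_{y ≠ p₀} [V(dist (p₀ + u) y) − V(dist p₀ y)] = ΔE_V(u)`. [folklore] -/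
theorem f_zero_sub_f_norm_le {P : PeriodicConfiguration 3} {ρ c : ℝ} {g U f : ℝ → ℝ}
    (h : IsSplit ρ c g U f) (hv : c + f 0 / 2 ≤ -(P.energyPerParticle lennardJones))
    {p₀ u : E3} (hp₀ : p₀ ∈ P.points) (hu : p₀ + u ∉ P.points) :
    f 0 - f ‖u‖ ≤ ∑' q : {q : E3 // q ∈ P.points ∧ q ≠ p₀},
      (lennardJones (dist (p₀ + u) q.1) - lennardJones (dist p₀ q.1)) := by
  have h1 := f_zero_sub_f_le_lennardJones_cavity h hv hp₀ hu
  rwa [dist_comm, dist_self_add_right] at h1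

/-- **Symmetrised displacement form**: for `u` with `p₀ ± u ∉ P`,
`2 (f 0 − f ‖u‖) ≤ Σ'_{y ≠ p₀} [V(dist (p₀+u) y) + V(dist (p₀−u) y) − 2 V(dist p₀ y)]` — a lattice
sum of symmetric second differences (the first-order terms of `ΔE_V(u)` and `ΔE_V(−u)` cancel).
[folklore] -/
theorem two_mul_f_zero_sub_f_norm_le {P : PeriodicConfiguration 3} {ρ c : ℝ} {g U f : ℝ → ℝ}
    (h : IsSplit ρ c g U f) (hv : c + f 0 / 2 ≤ -(P.energyPerParticle lennardJones))
    {p₀ u : E3} (hp₀ : p₀ ∈ P.points) (hu : p₀ + u ∉ P.points) (hu' : p₀ - u ∉ P.points) :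
    2 * (f 0 - f ‖u‖) ≤ ∑' q : {q : E3 // q ∈ P.points ∧ q ≠ p₀},
      (lennardJones (dist (p₀ + u) q.1) + lennardJones (dist (p₀ - u) q.1)
        - 2 * lennardJones (dist p₀ q.1)) := by
  have h1 := f_zero_sub_f_norm_le h hv hp₀ hu
  have h2 : f 0 - f ‖u‖ ≤ ∑' q : {q : E3 // q ∈ P.points ∧ q ≠ p₀},
      (lennardJones (dist (p₀ - u) q.1) - lennardJones (dist p₀ q.1)) := by
    have h3 := f_zero_sub_f_norm_le h hv hp₀ (u := -u) (by rwa [← sub_eq_add_neg])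
    rwa [norm_neg, ← sub_eq_add_neg] at h3
  have hs1 := summable_lennardJones_cavity_excess P (p₀ := p₀) hu
  have hs2 := summable_lennardJones_cavity_excess P (p₀ := p₀) hu'
  rw [show (fun q : {q : E3 // q ∈ P.points ∧ q ≠ p₀} =>
      lennardJones (dist (p₀ + u) q.1) + lennardJones (dist (p₀ - u) q.1)
        - 2 * lennardJones (dist p₀ q.1)) =
      fun q => (lennardJones (dist (p₀ + u) q.1) - lennardJones (dist p₀ q.1))
        + (lennardJones (dist (p₀ - u) q.1) - lennardJones (dist p₀ q.1)) from
      funext fun q => by ring, hs1.tsum_add hs2]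
  linarith

/-- **Registered sub-goal `einsteinLJ_of_clauses`** (crux conjuncts 2–7 verbatim as hypotheses): the
`g`-free Einstein bound holds for every witness of `StrictCertificate` (indeed of `ExactCertificate`):
`f 0 − f(dist w p₀) ≤ ΔE_V(p₀ ↦ w)` for every site `p₀ ∈ P` and probe `w ∉ P`. [folklore] -/
theorem einsteinLJ_of_clauses : ∀ (P : Literature.MathematicalPhysics.StatisticalMechanics.PeriodicConfiguration 3) (ρ c : ℝ) (g U f : ℝ → ℝ), (∀ r : ℝ, 0 < r → Literature.MathematicalPhysics.StatisticalMechanics.lennardJones r = g r + U r + f r) → (∀ r : ℝ, 0 < r → 0 ≤ U r) → (∀ r : ℝ, ρ ≤ r → g r = 0) → (∀ (n : ℕ) (y : Fin n → EuclideanSpace ℝ (Fin 3)) (w : Fin n → ℝ), 0 ≤ ∑ i, ∑ j, w i * w j * f (dist (y i) (y j))) → (∀ (N : ℕ) (x : Fin N → EuclideanSpace ℝ (Fin 3)), Function.Injective x → -(c * (N : ℝ)) ≤ Literature.MathematicalPhysics.StatisticalMechanics.interactionEnergy g x) → c + f 0 / 2 = -(P.energyPerParticle Literature.MathematicalPhysics.StatisticalMechanics.lennardJones)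 → ∀ p₀ ∈ P.points, ∀ w ∉ P.points, f 0 - f (dist w p₀) ≤ ∑' q : {q : EuclideanSpace ℝ (Fin 3) // q ∈ P.points ∧ q ≠ p₀}, (Literature.MathematicalPhysics.StatisticalMechanics.lennardJones (dist w q.1) - Literature.MathematicalPhysics.StatisticalMechanics.lennardJones (dist p₀ q.1)) :=
  fun _P _ρ _c _g _U _f h1 h2 h3 h4 h5 h6 _p₀ hp₀ _w hw =>
    f_zero_sub_f_le_lennardJones_cavity ⟨h1, h2, h3, h4, h5⟩ h6.le hp₀ hw

end Summit.AtomisticToContinuum.Crystallization.Theorems.BraggSlacknessRigidityStrictCertificate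

end
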